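import Mathlib.FieldTheory.SeparablyGenerated
import Mathlib.FieldTheory.IsSepClosed
import Mathlib.FieldTheory.AlgebraicClosure
import Mathlib.RingTheory.AlgebraicIndependent.Transcendental
import Literature.NumberTheory.DiophantineGeometry.FunctionFieldConstantExtensionSplittingProofs
import Literature.NumberTheory.DiophantineGeometry.FunctionFieldConstantExtensionGenusProofs
import Literature.NumberTheory.DiophantineGeometry.FunctionFieldFrobeniusLiftProofs
import Literature.NumberTheory.DiophantineGeometry.FunctionFieldPointCountRationalProofs
import Literature.NumberTheory.DiophantineGeometry.FunctionFieldSchmidtDegreeOneExtensionProofs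
import Literature.NumberTheory.DiophantineGeometry.FunctionFieldGenusInfinitePlacesProofs
import HarnessLib

/-!
# The Hasse–Weil theorem (Stichtenoth Thm. 5.2.1) and the discharge of `isGenus_genus` (Weil 1948)

This file **discharges two named facts**:

* `hasseWeil_holds : hasseWeil K F` (`FunctionFieldZeta`; **Stichtenoth Thm. 5.2.1**, the Riemann
  hypothesis for function fields over finite fields): the reciprocal roots of the `L`-polynomial of
  a function field `F/𝔽_q` with full constant field `𝔽_q` have absolute value `√q`;
* `isGenus_genus_holds : isGenus_genus Fq F` (`FunctionFieldGenus`; **Weil 1948**): Weil's counting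
  characterisation of the genus holds for the Riemann–Roch genus — via
  `isGenus_genus_of_hasseWeil` (F. K. Schmidt's theorem, already in the tree) and `hasseWeil_holds`.

## The proof (Bombieri–Stepanov, twisted form; Stichtenoth §5.2)

The argument assembles the sibling proof files of this chain:

1. *Reduction* (`FunctionFieldHasseWeilReductionProofs`): it suffices to bound
   `|N_{ks} - (q^{ks}+1)| ≤ c q^{ks/2}` along the multiples of one even `k` (Cor. 5.1.16, power sums).
2. *Stepanov's bound, twisted* (`FunctionFieldStepanovProofs`): for a function field `Ω/𝔽_Q`,
   `Q`-rational places fixed by an automorphism `θ` acting as `c ↦ c^{q^r}` on constants number at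
   most `q^r + (2g+1) q^{r/2}` when `q^r` is a square `> (g+1)⁴`.
3. *Double counting through Hilbert theory* (`FunctionFieldHilbertRamification`,
   `FunctionFieldFrobeniusLiftProofs`): for `Ω/L` Galois with finite full constant field `𝔽_{q^R}`,
   `R ∑_θ N_θ = [Ω:L] N_r(L)` and `R #{θ} = [Ω:L]`, summing over the automorphisms `θ` of `Ω/L`
   inducing `c ↦ c^{q^r}` on `𝔽_{q^R}`, provided the places of `Ω` above places of `L` of degree
   dividing `r` are rational.
4. *The model* (`FunctionFieldConstantExtension*`): `Ω = E[X]/(ψ)` for the Galois closure `E` of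
   `F/𝔽_q(t)` (`t` separating) and `ψ` irreducible of degree `r[E:𝔽_q(t)]` over the full constant
   field `k_E` of `E`; its genus is `≤ g(E)` uniformly in `r`, the rationality proviso holds
   (`isRational_of_restrict_eq`), and `Ω/𝔽_q(t)` is Galois (`isGalois_base_adjoinRoot_map`, via
   `IsSplittingField.mul`).
5. *The two-sided estimate* (`pointCount_bounds_of_galois`, this file): applying 2–3 to `L = F` gives
   `N_r(F) ≤ q^r + (2g+1)q^{r/2}` (5.23); applying them to `L = F₀ = 𝔽_q(t)`, where
   `N_r(F₀) = q^r + 1` (`pointCount_adjoin_simple`), and comparing through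
   `Gal(Ω/F) ⊆ Gal(Ω/F₀)` gives `q^r + 1 ≤ N_r(F) + ([F:F₀]-1)(2g+1)q^{r/2}` (5.24).

Compared with the printed proof, the intermediate fields `E^{⟨σ⟩}` of Prop. 5.2.7–5.2.8 are replaced
by Bombieri's twisted counts `N_θ` on the single field `Ω`, which avoids the theory of constant
fields and genera of fixed fields; the inequalities obtained are the same (5.23)/(5.24).

Genuine definitions: none (instances on the model and on `algebraicClosure k E`, theorems).
No new named facts.

## References

* H. Stichtenoth, *Algebraic Function Fields and Codes*, 2nd ed., GTM 254, Springer 2009, §5.2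
  (Thm. 5.2.1, Lemma 5.2.2, Prop. 5.2.3, Prop. 5.2.6–5.2.8), §3.6, §3.7, Prop. 3.10.2,
  Cor. 1.1.16. [Stichtenoth2009]
* E. Bombieri, *Counting points on curves over finite fields (d'après S. A. Stepanov)*,
  Sém. Bourbaki exp. 430 (1974). [Bombieri1974]
* A. Weil, *Sur les courbes algébriques et les variétés qui s'en déduisent*, Hermann 1948. [Weil1948]
-/

noncomputable section

open scoped Classical Polynomial IntermediateField

namespace Literature.NumberTheory.DiophantineGeometry.AlgFunctionField

open Polynomial

universe u v v' w x

/-! ### The two-sided estimate (5.23)/(5.24) from a Galois model (Stichtenoth Prop. 5.2.6–5.2.8) -/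

section AbstractBound

variable {k : Type u} [Field k] [Fintype k]
variable {F₀ : Type v} [Field F₀] [Algebra k F₀] [IsAlgFunctionField k F₀] [IsIntegrallyClosedIn k F₀]
variable {F : Type v'} [Field F] [Algebra k F] [Algebra F₀ F] [IsScalarTower k F₀ F]
  [IsAlgFunctionField k F] [IsIntegrallyClosedIn k F] [FiniteDimensional F₀ F]
variable {Ω : Type w} [Field Ω] [Algebra F Ω] [Algebra F₀ Ω] [Algebra k Ω] [IsScalarTower F₀ F Ω]
  [IsScalarTower k F Ω] [IsScalarTower k F₀ Ω] [FiniteDimensional F Ω] [FiniteDimensional F₀ Ω]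
  [IsGalois F Ω] [IsGalois F₀ Ω]
variable {K' : Type x} [Field K'] [Fintype K'] [Algebra K' Ω] [Algebra k K'] [IsScalarTower k K' Ω]
  [IsAlgFunctionField K' Ω] [IsIntegrallyClosedIn K' Ω]

omit [IsScalarTower k F₀ F] in
/-- **The two-sided estimate for `N_r(F)` from a Galois model** (the content of Stichtenoth
Prop. 5.2.6–5.2.8 and of the "End of the proof of the Hasse–Weil Theorem", pp. 201–208, in
Bombieri's twisted form). Data: `k = 𝔽_q ⊆ F₀ ⊆ F ⊆ Ω` function fields with full constant field `k`
for `F₀`, `F`, and a finite full constant field `K' = 𝔽_{q^R}` for `Ω`; `Ω/F₀` (hence `Ω/F`) finite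
Galois; `q^r = (p^e)²` a square `> (g(Ω)+1)⁴`; every place of `Ω` above a place of `F` or of `F₀` of
degree dividing `r` is `K'`-rational; and `N_r(F₀) = q^r + 1`. Then
`N_r(F) ≤ q^r + (2g(Ω)+1) p^e` and `q^r + 1 ≤ N_r(F) + ([F:F₀] - 1)(2g(Ω)+1) p^e`.
Proof: the double counts `R ∑_θ N_θ = [Ω:L] N_r(L)` for `L = F, F₀`
(`PlaceOver.mul_sum_natCard_fixed_eq_card_mul_pointCount`), the fibre counts
`R · #{θ} = [Ω:L]` (`finrank_mul_natCard_algEquiv_restrict_eq`), the twisted Stepanov bound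
`N_θ ≤ q^r + (2g+1)p^e` (`natCard_isRational_comapRingEquiv_eq_le`), and `Gal(Ω/F) ⊆ Gal(Ω/F₀)`.
[cite: Stichtenoth2009, Prop. 5.2.6–5.2.8 and proof of Thm. 5.2.1] -/
theorem pointCount_bounds_of_galois (p : ℕ) [ExpChar K' p] {e r R : ℕ} (hr : 0 < r)
    (hqr : Fintype.card k ^ r = (p ^ e) ^ 2) (hK' : Nat.card K' = Nat.card k ^ R)
    (hsplitF : ∀ P : PlaceOver k F, P.degree ∣ r →
      ∀ Q : PlaceOver K' Ω, Q.restrict (K := k) (F := F) = P → Q.IsRational)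
    (hsplit₀ : ∀ P : PlaceOver k F₀, P.degree ∣ r →
      ∀ Q : PlaceOver K' Ω, Q.restrict (K := k) (F := F₀) = P → Q.IsRational)
    (hg : (genus K' Ω + 1) ^ 4 < (p ^ e) ^ 2)
    (h₀ : pointCount k F₀ r = Fintype.card k ^ r + 1) :
    pointCount k F r ≤ (p ^ e) ^ 2 + (2 * genus K' Ω + 1) * p ^ e ∧
      (p ^ e) ^ 2 + 1 ≤ pointCount k F r +
        (Module.finrank F₀ F - 1) * ((2 * genus K' Ω + 1) * p ^ e) := by
  -- notation
  set q : ℕ := Fintype.card k with hq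
  have hqk : Nat.card k = q := Nat.card_eq_fintype_card
  set M : ℕ := (p ^ e) ^ 2 + (2 * genus K' Ω + 1) * p ^ e with hM
  let N : (Ω ≃+* Ω) → ℕ := fun θ =>
    Nat.card {Q : PlaceOver K' Ω // Q.IsRational ∧ Q.comapRingEquiv θ = Q}
  let cond : (Ω ≃+* Ω) → Prop := fun θ =>
    ∀ c : K', θ (algebraMap K' Ω c) = algebraMap K' Ω (c ^ Nat.card k ^ r)
  -- Stepanov's bound for every admissible `θ`
  have hStep : ∀ θ : Ω ≃+* Ω, cond θ → N θ ≤ M := by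
    intro θ hθ
    refine natCard_isRational_comapRingEquiv_eq_le p e θ (fun c => ?_) hg
    rw [hθ c, hqk, hqr]
  -- the Frobenius power as a `k`-algebra map of `K'`, and `[K' : k] = R`
  set φ : K' →ₐ[k] K' := FiniteField.frobeniusAlgHom k K' ^ r with hφ
  have hφc : ∀ c : K', φ c = c ^ Nat.card k ^ r := fun c => by
    rw [hφ, AlgHom.coe_pow, FiniteField.coe_frobeniusAlgHom, pow_iterate, hqk]
  have hq1 : 1 < q := Fintype.one_lt_card
  have hRK : Module.finrank k K' = R := by
    have h := Module.natCard_eq_pow_finrank (K := k) (V := K')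
    rw [hK', hqk] at h
    exact (Nat.pow_right_injective hq1 h).symm
  -- the double counts and fibre counts, for `L = F` and `L = F₀`
  have hDCF := PlaceOver.mul_sum_natCard_fixed_eq_card_mul_pointCount (k := k) (L := F) (Ω := Ω)
    (K' := K') hr hK' hsplitF
  have hDC0 := PlaceOver.mul_sum_natCard_fixed_eq_card_mul_pointCount (k := k) (L := F₀) (Ω := Ω)
    (K' := K') hr hK' hsplit₀
  have hFCF := finrank_mul_natCard_algEquiv_restrict_eq (k := k) (L := F) (Ω := Ω) (K' := K') φ
  have hFC0 := finrank_mul_natCard_algEquiv_restrict_eq (k := k) (L := F₀) (Ω := Ω) (K' := K') φ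
  simp only [hφc] at hFCF hFC0
  rw [hRK] at hFCF hFC0
  rw [h₀] at hDC0
  -- abbreviations for the two index types
  set SF := {θ : Ω ≃ₐ[F] Ω // ∀ c : K', θ (algebraMap K' Ω c) = algebraMap K' Ω (c ^ Nat.card k ^ r)}
    with hSF
  set S0 := {θ : Ω ≃ₐ[F₀] Ω // ∀ c : K', θ (algebraMap K' Ω c) = algebraMap K' Ω (c ^ Nat.card k ^ r)}
    with hS0
  -- `Gal(Ω/F) ↪ Gal(Ω/F₀)` restricted to the admissible automorphisms
  let ρ : SF → S0 := fun θ => ⟨θ.1.restrictScalars F₀, fun c => θ.2 c⟩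
  have hρ : Function.Injective ρ := by
    intro θ θ' h
    apply Subtype.ext
    have := congr_arg Subtype.val h
    exact AlgEquiv.restrictScalars_injective F₀ this
  -- the sums
  have hsumF : ∑ θ : SF, N (θ.1 : Ω ≃+* Ω) ≤ Nat.card SF * M := by
    calc ∑ θ : SF, N (θ.1 : Ω ≃+* Ω) ≤ ∑ _θ : SF, M :=
          Finset.sum_le_sum fun θ _ => hStep _ fun c => θ.2 c
      _ = Nat.card SF * M := by
          rw [Finset.sum_const, smul_eq_mul, Finset.card_univ, Nat.card_eq_fintype_card (α := SF)]
  have hsum0 : ∑ θ : S0, N (θ.1 : Ω ≃+* Ω) ≤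
      ∑ θ : SF, N (θ.1 : Ω ≃+* Ω) + (Nat.card S0 - Nat.card SF) * M := by
    have himg : ∑ θ ∈ Finset.univ.image ρ, N (θ.1 : Ω ≃+* Ω) = ∑ θ : SF, N (θ.1 : Ω ≃+* Ω) := by
      rw [Finset.sum_image fun θ _ θ' _ h => hρ h]
      exact Finset.sum_congr rfl fun x _ => rfl
    have hsplit := Finset.sum_sdiff (f := fun θ : S0 => N (θ.1 : Ω ≃+* Ω))
      (Finset.subset_univ (Finset.univ.image ρ))
    rw [himg] at hsplit
    have hrest : ∑ θ ∈ Finset.univ \ Finset.univ.image ρ, N (θ.1 : Ω ≃+* Ω) ≤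
        (Nat.card S0 - Nat.card SF) * M := by
      calc ∑ θ ∈ Finset.univ \ Finset.univ.image ρ, N (θ.1 : Ω ≃+* Ω)
          ≤ ∑ _θ ∈ Finset.univ \ Finset.univ.image ρ, M :=
            Finset.sum_le_sum fun θ _ => hStep _ fun c => θ.2 c
        _ = (Nat.card S0 - Nat.card SF) * M := by
            rw [Finset.sum_const, smul_eq_mul, Finset.card_sdiff_of_subset (Finset.subset_univ _),
              Finset.card_univ, Finset.card_image_of_injective _ hρ, Finset.card_univ,
              Nat.card_eq_fintype_card (α := S0), Nat.card_eq_fintype_card (α := SF)]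
    rw [← hsplit]
    omega
  have hcardle : Nat.card SF ≤ Nat.card S0 := Nat.card_le_card_of_injective ρ hρ
  -- group orders: `|Gal(Ω/F₀)| = [F : F₀] · |Gal(Ω/F)|`
  have hΓ : Nat.card (Ω ≃ₐ[F₀] Ω) = Module.finrank F₀ F * Nat.card (Ω ≃ₐ[F] Ω) := by
    rw [IsGalois.card_aut_eq_finrank, IsGalois.card_aut_eq_finrank, Module.finrank_mul_finrank]
  have hΓF : 0 < Nat.card (Ω ≃ₐ[F] Ω) := Nat.card_pos
  have hn₀ : 1 ≤ Module.finrank F₀ F := Module.finrank_pos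
  -- the two double counts in terms of `N`
  have e1 : R * (∑ θ : SF, N (θ.1 : Ω ≃+* Ω)) = Nat.card (Ω ≃ₐ[F] Ω) * pointCount k F r := by
    convert hDCF using 4
  have e2 : R * (∑ θ : S0, N (θ.1 : Ω ≃+* Ω)) = Nat.card (Ω ≃ₐ[F₀] Ω) * (q ^ r + 1) := by
    convert hDC0 using 4
  set sF := ∑ θ : SF, N (θ.1 : Ω ≃+* Ω) with hsF
  set s0 := ∑ θ : S0, N (θ.1 : Ω ≃+* Ω) with hs0
  set ΓF := Nat.card (Ω ≃ₐ[F] Ω) with hΓFdef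
  set Γ0 := Nat.card (Ω ≃ₐ[F₀] Ω) with hΓ0def
  set n₀ := Module.finrank F₀ F with hn₀def
  set NF := pointCount k F r with hNF
  set cF := Nat.card SF with hcF
  set c0 := Nat.card S0 with hc0
  set g := genus K' Ω with hgdef
  have hle : ΓF ≤ Γ0 := by rw [hΓ]; exact Nat.le_mul_of_pos_left _ hn₀
  constructor
  · -- upper bound (5.23)
    have h1 : ΓF * NF ≤ ΓF * M := by
      rw [← e1]
      calc R * sF ≤ R * (cF * M) := Nat.mul_le_mul_left _ hsumF
        _ = ΓF * M := by rw [← mul_assoc, hFCF]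
    exact Nat.le_of_mul_le_mul_left h1 hΓF
  · -- lower bound (5.24)
    have h2 : Γ0 * (q ^ r + 1) ≤ ΓF * NF + (Γ0 - ΓF) * M := by
      rw [← e2]
      calc R * s0 ≤ R * (sF + (c0 - cF) * M) := Nat.mul_le_mul_left _ hsum0
        _ = R * sF + (R * c0 - R * cF) * M := by rw [mul_add, ← mul_assoc, mul_tsub]
        _ = ΓF * NF + (Γ0 - ΓF) * M := by rw [e1, hFCF, hFC0]
    rw [hΓ] at h2
    have h2' : ΓF * (n₀ * (q ^ r + 1)) ≤ ΓF * (NF + (n₀ - 1) * M) := by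
      have eq1 : n₀ * ΓF * (q ^ r + 1) = ΓF * (n₀ * (q ^ r + 1)) := by ring
      have eq2 : ΓF * NF + (n₀ * ΓF - ΓF) * M = ΓF * (NF + (n₀ - 1) * M) := by
        rw [show n₀ * ΓF - ΓF = (n₀ - 1) * ΓF by rw [tsub_mul, one_mul]]; ring
      rw [eq1, eq2] at h2; exact h2
    have h3 : n₀ * (q ^ r + 1) ≤ NF + (n₀ - 1) * M := Nat.le_of_mul_le_mul_left h2' hΓF
    obtain ⟨a, ha⟩ : ∃ a, n₀ = a + 1 := ⟨n₀ - 1, by omega⟩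
    rw [ha, Nat.add_sub_cancel, hM, ← hqr] at h3
    rw [ha, Nat.add_sub_cancel, ← hqr]
    have h4 : a * q ^ r + a + q ^ r + 1 ≤ NF + a * q ^ r + a * ((2 * g + 1) * p ^ e) := by
      have := h3; ring_nf at this ⊢; linarith
    linarith

end AbstractBound

/-! ### The construction: separating element, Galois closure, constant field, constant extensions -/

section Construction

variable {K : Type u} {F : Type v} [Field K] [Fintype K] [Field F] [Algebra K F]
  [IsAlgFunctionField K F] [IsIntegrallyClosedIn K F]

omit [IsIntegrallyClosedIn K F] in
/-- **Stage 1.** A separating element: `t ∈ F` transcendental over `𝔽_q` with `F/𝔽_q(t)` finite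
separable (Stichtenoth Prop. 3.10.2; Mathlib's separably-generated theorem for perfect base fields).
[cite: Stichtenoth2009, Prop. 3.10.2] -/
theorem exists_separating : ∃ t : F, Transcendental K t ∧ Algebra.IsSeparable K⟮t⟯ F := by
  haveI : Algebra.EssFiniteType K F := IntermediateField.fg_top_iff.1 IsAlgFunctionField.fg_top
  obtain ⟨s, hsb, hsep⟩ := exists_isTranscendenceBasis_and_isSeparable_of_perfectField K F
  have hs1 : s.card = 1 := by
    have h := hsb.lift_cardinalMk_eq_trdeg
    rw [IsAlgFunctionField.trdeg_eq_one (K := K) (F := F), Cardinal.mk_coe_finset, Cardinal.lift_one,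
      Cardinal.lift_natCast] at h
    exact_mod_cast h
  obtain ⟨t, rfl⟩ := Finset.card_eq_one.1 hs1
  refine ⟨t, ?_, ?_⟩
  · exact hsb.1.transcendental ⟨t, Finset.mem_singleton_self t⟩
  · rwa [Finset.coe_singleton] at hsep

omit [Fintype K] [IsAlgFunctionField K F] in
/-- `K` is integrally closed in every intermediate field of `F/K` if it is so in `F`. [folklore] -/
theorem isIntegrallyClosedIn_intermediateField (M : IntermediateField K F) : IsIntegrallyClosedIn K M := by
  rw [isIntegrallyClosedIn_iff]
  refine ⟨(algebraMap K M).injective, fun {x} hx => ?_⟩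
  have hx' : IsIntegral K (x : F) := hx.map (IsScalarTower.toAlgHom K M F)
  obtain ⟨c, hc⟩ := IsIntegrallyClosedIn.algebraMap_eq_of_integral hx'
  refine ⟨c, Subtype.ext ?_⟩
  rw [← hc]; rfl

end Construction

/-! ### The model `Ω = E𝔽_{q^R}`: Galois over `F₀`, rational places above small-degree places -/

section Model

universe u'

variable {k : Type u} [Field k] [Fintype k]
variable {E : Type w} [Field E] [Algebra k E] [IsAlgFunctionField k E]
variable (kE : Type u') [Field kE] [Fintype kE] [Algebra kE E] [Algebra k kE] [IsScalarTower k kE E]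
  [IsIntegrallyClosedIn kE E] [IsAlgFunctionField kE E]
variable (ψ : kE[X]) [hirr : Fact (Irreducible ψ)]

/-- `k → K' → Ω` is a scalar tower (`K' = k_E[X]/(ψ)`, `Ω = E[X]/(ψ)`). [folklore] -/
instance isScalarTower_base_adjoinRoot :
    IsScalarTower k (AdjoinRoot ψ) (AdjoinRoot (ψ.map (algebraMap kE E))) :=
  IsScalarTower.of_algebraMap_eq fun c => by
    rw [IsScalarTower.algebraMap_apply k kE (AdjoinRoot ψ),
      ← IsScalarTower.algebraMap_apply kE (AdjoinRoot ψ) (AdjoinRoot (ψ.map (algebraMap kE E))),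
      IsScalarTower.algebraMap_apply kE E (AdjoinRoot (ψ.map (algebraMap kE E))),
      IsScalarTower.algebraMap_apply k E (AdjoinRoot (ψ.map (algebraMap kE E))),
      IsScalarTower.algebraMap_apply k kE E]

omit [Fintype k] in
/-- `#K' = q^{[k_E:k] · deg ψ}`. [folklore] -/
theorem natCard_adjoinRoot_eq_pow :
    Nat.card (AdjoinRoot ψ) = Nat.card k ^ (Module.finrank k kE * ψ.natDegree) := by
  rw [natCard_adjoinRoot, Module.natCard_eq_pow_finrank (K := k) (V := kE), pow_mul]

section OverL

variable {L : Type v'} [Field L] [Algebra k L] [Algebra L E] [IsScalarTower k L E]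
  [IsAlgFunctionField k L] [FiniteDimensional L E] [IsGalois L E]

/-- `Ω/L` is finite-dimensional (through `E`). [folklore] -/
instance finiteDimensional_base_adjoinRoot_map :
    FiniteDimensional L (AdjoinRoot (ψ.map (algebraMap kE E))) :=
  Module.Finite.trans E _

/-- **Restriction through the constant field.** For a place `Q` of `Ω` and its restriction `Q_E`
to `E` (a place of `E/k_E`): the place of `E/k` with the same ring restricts to `Q ∩ L`, and
`deg_k = deg_{k_E} · [k_E : k]`. [cite: Stichtenoth2009, Def. 1.1.14 (b)] -/
theorem degree_restrict_dvd {r n : ℕ} (hψ : ψ.natDegree = r * n)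
    (hn : Module.finrank L E ∣ n) (P : PlaceOver k L) (hP : P.degree ∣ r)
    (Q : PlaceOver (AdjoinRoot ψ) (AdjoinRoot (ψ.map (algebraMap kE E))))
    (hQ : Q.restrict (K := k) (F := L) = P) :
    (Q.restrict (K := kE) (F := E)).degree ∣ ψ.natDegree := by
  set QE := Q.restrict (K := kE) (F := E) with hQE
  set QE' := Q.restrict (K := k) (F := E) with hQE'
  -- (i) degrees over `k` and over `k_E`
  have hdeg : QE'.degree = Module.finrank k kE * QE.degree := by
    letI : Algebra k QE.residueField := show Algebra k QE'.residueField from inferInstance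
    haveI : IsScalarTower k kE QE.residueField := IsScalarTower.of_algebraMap_eq fun c => by
      change IsLocalRing.residue _ (algebraMap k QE'.toValuationSubring c) =
        IsLocalRing.residue _ (algebraMap kE QE.toValuationSubring (algebraMap k kE c))
      congr 1
      apply Subtype.ext
      exact IsScalarTower.algebraMap_apply k kE E c
    change Module.finrank k QE.residueField = _
    rw [← Module.finrank_mul_finrank k kE QE.residueField]
    rfl
  -- (ii) `Q_E ∩ L = P`
  have hQE'P : QE'.restrict (K := k) (F := L) = P := by
    rw [← hQ]
    apply PlaceOver.ext; ext x
    rw [PlaceOver.mem_restrict_iff, PlaceOver.mem_restrict_iff, PlaceOver.mem_restrict_iff,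
      ← IsScalarTower.algebraMap_apply L E]
  have hQP' := (PlaceOver.restrict_eq_iff QE' P).1 hQE'P
  -- (iii) Hilbert theory for `E/L`: `f ∣ [E : L]` and `deg_k Q_E = f · deg P`
  haveI := P.finite_residueField
  haveI : Finite (P.toValuationSubring ⧸ IsLocalRing.maximalIdeal P.toValuationSubring) :=
    ‹Finite P.residueField›
  haveI : PerfectField (IsLocalRing.maximalIdeal P.toValuationSubring).ResidueField := inferInstance
  have hH := Ideal.ncard_primesOver_mul_card_inertia_mul_finrank (G := E ≃ₐ[L] E)
    (IsLocalRing.maximalIdeal P.toValuationSubring) (PlaceOver.primeBelow QE' hQP')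
  rw [IsGalois.card_aut_eq_finrank] at hH
  set f := (PlaceOver.primeBelow QE' hQP').inertiaDeg P.toValuationSubring with hf
  have hfdvd : f ∣ Module.finrank L E := Dvd.intro_left _ hH
  have h1 := PlaceOver.natCard_residueField_eq_natCard_quotient QE' hQP'
  have h2 := PlaceOver.natCard_quotient_primeBelow_eq_pow QE' hQP'
  rw [h2, PlaceOver.natCard_residueField P, PlaceOver.natCard_residueField QE', ← pow_mul] at h1
  have hdeg' : QE'.degree = P.degree * f := Nat.pow_right_injective Finite.one_lt_card h1
  -- (iv) divisibility
  have hdvd : P.degree * f ∣ ψ.natDegree := by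
    rw [hψ]; exact mul_dvd_mul hP (hfdvd.trans hn)
  rw [← hdeg', hdeg] at hdvd
  exact dvd_of_mul_left_dvd hdvd

/-- **`hsplit` for the model**: every place of `Ω` above a place of `L` (`L = F` or `F₀`, with
`E/L` Galois and `[E : L] ∣ n`, `deg ψ = r n`) of degree dividing `r` is `K'`-rational.
[cite: Stichtenoth2009, Lemma 5.1.9(d)] -/
theorem isRational_of_restrict_eq_of_dvd {r n : ℕ} (hψ : ψ.natDegree = r * n)
    (hn : Module.finrank L E ∣ n) :
    ∀ P : PlaceOver k L, P.degree ∣ r →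
      ∀ Q : PlaceOver (AdjoinRoot ψ) (AdjoinRoot (ψ.map (algebraMap kE E))),
        Q.restrict (K := k) (F := L) = P → Q.IsRational := by
  intro P hP Q hQ
  exact isRational_of_restrict_eq ψ (Q.restrict (K := kE) (F := E))
    (degree_restrict_dvd kE ψ hψ hn P hP Q hQ) Q rfl

end OverL

section Galois

universe v₀
variable {F₀ : Type v₀} [Field F₀] [Algebra k F₀] [Algebra F₀ E] [IsScalarTower k F₀ E]
  [FiniteDimensional F₀ E] [IsGalois F₀ E]

omit [Fintype k] [IsAlgFunctionField k E] [IsAlgFunctionField kE E] in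
include k in
/-- **`Ω = E𝔽_{q^R}` is Galois over `F₀`**: `E` is the splitting field over `F₀` of a separable
polynomial, `Ω` is the splitting field over `E` of the minimal polynomial over `k` of a generator of
`K'` (all of whose roots are constants, lying in `K' ⊆ Ω`), so `Ω` is a splitting field over `F₀`
(Mathlib `IsSplittingField.mul`), hence normal; and `Ω/E/F₀` is separable.
[cite: Stichtenoth2009, Thm. 3.6.3 and proof of Thm. 5.2.1 ("`E'/L` is Galois")] -/
theorem isGalois_base_adjoinRoot_map : IsGalois F₀ (AdjoinRoot (ψ.map (algebraMap kE E))) := by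
  haveI := isGalois_adjoinRoot_map (F := E) ψ
  obtain ⟨pE, -, hpE⟩ := IsGalois.is_separable_splitting_field F₀ E
  -- a nonzero polynomial of which `E` is the splitting field
  obtain ⟨p₁, hp₁0, hp₁⟩ : ∃ p₁ : F₀[X], p₁ ≠ 0 ∧ p₁.IsSplittingField F₀ E := by
    rcases eq_or_ne pE 0 with h0 | h0
    · refine ⟨1, one_ne_zero, ⟨by simp, ?_⟩⟩
      have h := hpE.adjoin_rootSet'
      rw [h0] at h
      simpa [rootSet] using h
    · exact ⟨pE, h0, hpE⟩
  haveI := hp₁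
  haveI : Fintype (AdjoinRoot ψ) := Fintype.ofFinite _
  set β : AdjoinRoot ψ := AdjoinRoot.root ψ with hβdef
  have hβ : IsIntegral k β := IsIntegral.of_finite k β
  set μ : k[X] := minpoly k β with hμ
  have hμ0 : μ ≠ 0 := minpoly.ne_zero hβ
  -- `Ω` is the splitting field of `μ` over `E`
  have hSF : IsSplittingField E (AdjoinRoot (ψ.map (algebraMap kE E))) (μ.map (algebraMap k E)) := by
    constructor
    · have hspl : Splits ((μ.map (algebraMap k (AdjoinRoot ψ))).map
          (algebraMap (AdjoinRoot ψ) (AdjoinRoot (ψ.map (algebraMap kE E))))) :=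
        (Normal.splits (inferInstance : Normal k (AdjoinRoot ψ)) β).map _
      rw [Polynomial.map_map, ← IsScalarTower.algebraMap_eq] at hspl
      rw [Polynomial.map_map, ← IsScalarTower.algebraMap_eq k E]
      exact hspl
    · apply top_unique
      rw [← AdjoinRoot.adjoinRoot_eq_top]
      refine Algebra.adjoin_mono (Set.singleton_subset_iff.2 ?_)
      rw [mem_rootSet]
      refine ⟨Polynomial.map_ne_zero hμ0, ?_⟩
      rw [aeval_map_algebraMap, ← algebraMap_root ψ, aeval_algebraMap_apply, hμ, minpoly.aeval, map_zero]
  haveI : IsSplittingField E (AdjoinRoot (ψ.map (algebraMap kE E)))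
      ((μ.map (algebraMap k F₀)).map (algebraMap F₀ E)) := by
    rwa [Polynomial.map_map, ← IsScalarTower.algebraMap_eq]
  have hSF' := IsSplittingField.mul (F := F₀) (K := E) (L := AdjoinRoot (ψ.map (algebraMap kE E))) p₁
    (μ.map (algebraMap k F₀)) hp₁0 (Polynomial.map_ne_zero hμ0)
  haveI : Normal F₀ (AdjoinRoot (ψ.map (algebraMap kE E))) :=
    Normal.of_isSplittingField (p₁ * μ.map (algebraMap k F₀))
  haveI : Algebra.IsSeparable F₀ (AdjoinRoot (ψ.map (algebraMap kE E))) :=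
    Algebra.IsSeparable.trans F₀ E _
  exact isGalois_iff.2 ⟨inferInstance, inferInstance⟩

end Galois

end Model

/-! ### The constant field `k_E` of the Galois closure: finite, full, and `E/k_E` a function field -/

section ConstantField

variable {k : Type u} [Field k] [Fintype k]
variable {E : Type w} [Field E] [Algebra k E] [IsAlgFunctionField k E]

/-- **The full constant field of `E` is a finite extension of `k`** (Stichtenoth Cor. 1.1.16:
`k̃` embeds `k`-linearly in every residue field `E_P`, which is finite-dimensional).
[cite: Stichtenoth2009, Cor. 1.1.16] -/
instance finiteDimensional_algebraicClosure : FiniteDimensional k (algebraicClosure k E) := by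
  haveI : Infinite (PlaceOver k E) := infinite_placeOver_holds
  obtain ⟨P⟩ : Nonempty (PlaceOver k E) := inferInstance
  haveI : FiniteDimensional k P.residueField := PlaceOver.finiteDimensional_residueField_holds P
  have hmem : ∀ c : algebraicClosure k E, (c : E) ∈ P.toValuationSubring := fun c =>
    IsAlgFunctionField.mem_valuationSubring_of_isAlgebraic P.toValuationSubring P.algebraMap_mem
      (mem_algebraicClosure_iff.1 c.2)
  let f : algebraicClosure k E →ₗ[k] P.residueField :=
    { toFun := fun c => IsLocalRing.residue P.toValuationSubring ⟨c, hmem c⟩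
      map_add' := fun c c' => by rw [← map_add]; rfl
      map_smul' := fun a c => by
        rw [RingHom.id_apply, Algebra.smul_def, Algebra.smul_def,
          PlaceOver.algebraMap_residueField_apply, ← map_mul]
        rfl }
  refine Module.Finite.of_injective f fun c c' h => ?_
  -- injectivity: a nonzero algebraic element is a unit at `P`
  rw [← sub_eq_zero]
  by_contra hne
  have h0 : f (c - c') = 0 := by rw [map_sub, h, sub_self]
  change IsLocalRing.residue P.toValuationSubring ⟨(c - c' : algebraicClosure k E), hmem _⟩ = 0 at h0
  rw [IsLocalRing.residue_eq_zero_iff, IsLocalRing.mem_maximalIdeal, mem_nonunits_iff] at h0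
  apply h0
  have hne' : ((c - c' : algebraicClosure k E) : E) ≠ 0 := fun h' => hne (Subtype.ext h')
  have hinv : ((c - c' : algebraicClosure k E) : E)⁻¹ ∈ P.toValuationSubring := by
    have : ((c - c' : algebraicClosure k E) : E)⁻¹ = ((c - c')⁻¹ : algebraicClosure k E) := by simp
    rw [this]; exact hmem _
  exact ⟨⟨⟨_, hmem _⟩, ⟨_, hinv⟩, Subtype.ext (mul_inv_cancel₀ hne'), Subtype.ext (inv_mul_cancel₀ hne')⟩,
    rfl⟩

/-- The relative algebraic closure is finite. [cite: Stichtenoth2009, Cor. 1.1.16] -/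
instance finite_algebraicClosure : Finite (algebraicClosure k E) := Module.finite_of_finite k

/-- **`k_E` is the full constant field of `E`**: `k_E` is integrally closed in `E`. [cite: Stichtenoth2009, §1.1 (`K̃`)] -/
instance isIntegrallyClosedIn_algebraicClosure : IsIntegrallyClosedIn (algebraicClosure k E) E := by
  rw [isIntegrallyClosedIn_iff]
  refine ⟨(algebraMap (algebraicClosure k E) E).injective, fun {x} hx => ?_⟩
  have hx' : IsIntegral k x := isIntegral_trans x hx
  exact ⟨⟨x, mem_algebraicClosure_iff'.2 hx'⟩, rfl⟩

/-- **`E/k_E` is an algebraic function field of one variable** (`trdeg` does not change over an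
algebraic extension of the constants; finite generation is inherited). [cite: Stichtenoth2009, §1.1] -/
instance isAlgFunctionField_algebraicClosure : IsAlgFunctionField (algebraicClosure k E) E where
  trdeg_eq_one := by
    have h := lift_trdeg_add_eq k (algebraicClosure k E) E
    rw [trdeg_eq_zero (R := k) (A := algebraicClosure k E),
      IsAlgFunctionField.trdeg_eq_one (K := k) (F := E),
      Cardinal.lift_zero, zero_add, Cardinal.lift_one] at h
    exact Cardinal.lift_eq_one.1 h
  fg_top := by
    haveI : Algebra.EssFiniteType k E := IntermediateField.fg_top_iff.1 IsAlgFunctionField.fg_top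
    exact IntermediateField.fg_top_iff.2 (Algebra.EssFiniteType.of_comp k (algebraicClosure k E) E)

end ConstantField

/-! ### The bounds for a given Galois closure -/

section PerR

universe v₀

variable {k : Type u} [Field k] [Fintype k]
variable {F₀ : Type v₀} [Field F₀] [Algebra k F₀] [IsAlgFunctionField k F₀] [IsIntegrallyClosedIn k F₀]
variable {F : Type v} [Field F] [Algebra k F] [Algebra F₀ F] [IsScalarTower k F₀ F]
  [IsAlgFunctionField k F] [IsIntegrallyClosedIn k F] [FiniteDimensional F₀ F]
variable {E : Type w} [Field E] [Algebra k E] [Algebra F₀ E] [Algebra F E] [IsScalarTower F₀ F E]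
  [IsScalarTower k F₀ E] [IsScalarTower k F E] [FiniteDimensional F₀ E] [FiniteDimensional F E]
  [IsGalois F₀ E] [IsGalois F E] [IsAlgFunctionField k E]

omit [IsScalarTower k F₀ F] in
/-- **The two-sided estimate for one `r`, from the model `Ω = E𝔽_{q^R}`** built on an irreducible
`ψ` of degree `r · [E : F₀]` over a finite full constant field `k_E` of `E`.
[cite: Stichtenoth2009, proof of Thm. 5.2.1] -/
theorem pointCount_bounds_of_irreducible (kE : Type*) [Field kE] [Fintype kE] [Algebra kE E]
    [Algebra k kE] [IsScalarTower k kE E] [IsIntegrallyClosedIn kE E] [IsAlgFunctionField kE E]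
    (p : ℕ) (hp : p.Prime) [CharP k p] {e r : ℕ} (hr : 0 < r)
    (hqr : Fintype.card k ^ r = (p ^ e) ^ 2)
    (ψ : kE[X]) (hirr : Irreducible ψ) (hψ : ψ.natDegree = r * Module.finrank F₀ E)
    (hg : (genus kE E + 1) ^ 4 < (p ^ e) ^ 2)
    (h₀ : pointCount k F₀ r = Fintype.card k ^ r + 1) :
    pointCount k F r ≤ (p ^ e) ^ 2 + (2 * genus kE E + 1) * p ^ e ∧
      (p ^ e) ^ 2 + 1 ≤ pointCount k F r +
        (Module.finrank F₀ F - 1) * ((2 * genus kE E + 1) * p ^ e) := by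
  haveI : Fact (Irreducible ψ) := ⟨hirr⟩
  haveI := isGalois_base_adjoinRoot_map (k := k) (E := E) (F₀ := F₀) kE ψ
  haveI : IsGalois F (AdjoinRoot (ψ.map (algebraMap kE E))) :=
    IsGalois.tower_top_of_isGalois F₀ F _
  letI : Fintype (AdjoinRoot ψ) := Fintype.ofFinite _
  haveI : ExpChar k p := ExpChar.prime hp
  haveI : ExpChar (AdjoinRoot ψ) p :=
    expChar_of_injective_algebraMap (algebraMap k (AdjoinRoot ψ)).injective p
  have hKcard : Nat.card (AdjoinRoot ψ) = _ := natCard_adjoinRoot_eq_pow (k := k) kE ψ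
  have hgΩ := genus_adjoinRoot_map_le (F := E) ψ
  have hnF : Module.finrank F E ∣ Module.finrank F₀ E :=
    Dvd.intro_left _ (Module.finrank_mul_finrank F₀ F E)
  have hsplitF := isRational_of_restrict_eq_of_dvd (k := k) (E := E) kE ψ (L := F) hψ hnF
  have hsplit₀ := isRational_of_restrict_eq_of_dvd (k := k) (E := E) kE ψ (L := F₀) hψ dvd_rfl
  have hgΩ' : (genus (AdjoinRoot ψ) (AdjoinRoot (ψ.map (algebraMap kE E))) + 1) ^ 4 < (p ^ e) ^ 2 :=
    lt_of_le_of_lt (Nat.pow_le_pow_left (by omega) 4) hg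
  obtain ⟨hU, hL⟩ := pointCount_bounds_of_galois (k := k) (F₀ := F₀) (F := F)
    (Ω := AdjoinRoot (ψ.map (algebraMap kE E))) (K' := AdjoinRoot ψ) p hr hqr hKcard hsplitF hsplit₀
    hgΩ' h₀
  constructor
  · exact hU.trans (by gcongr)
  · exact hL.trans (by gcongr)

end PerR

section GivenClosure

universe v₀

variable {k : Type u} [Field k] [Fintype k]
variable {F₀ : Type v₀} [Field F₀] [Algebra k F₀] [IsAlgFunctionField k F₀] [IsIntegrallyClosedIn k F₀]
variable {F : Type v} [Field F] [Algebra k F] [Algebra F₀ F]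
  [IsAlgFunctionField k F] [IsIntegrallyClosedIn k F] [FiniteDimensional F₀ F]

/-- **The two-sided estimate for all large even `r`, from a Galois closure `E` of `F/F₀`**
(`F₀ = 𝔽_q(t)` with `N_r(F₀) = q^r + 1`): there is `G` (the genus of `E` over its full constant
field) with `N_{2r'}(F) ≤ q^{2r'} + (2G+1) q^{r'}` and
`q^{2r'} + 1 ≤ N_{2r'}(F) + ([F:F₀]-1)(2G+1) q^{r'}` whenever `q^{2r'} > (G+1)⁴`.
[cite: Stichtenoth2009, proof of Thm. 5.2.1, (5.23)–(5.24)] -/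
theorem exists_pointCount_bounds (E : Type w) [Field E] [Algebra k E] [Algebra F₀ E] [Algebra F E]
    [IsScalarTower F₀ F E] [IsScalarTower k F₀ E] [IsScalarTower k F E] [FiniteDimensional F₀ E]
    [FiniteDimensional F E] [IsGalois F₀ E] [IsGalois F E] [IsAlgFunctionField k E]
    (p a : ℕ) (hp : p.Prime) [CharP k p]
    (hq : Fintype.card k = p ^ a)
    (h₀ : ∀ r : ℕ, 0 < r → pointCount k F₀ r = Fintype.card k ^ r + 1) :
    ∃ G : ℕ, ∀ r' : ℕ, 0 < r' → (G + 1) ^ 4 < Fintype.card k ^ (2 * r') →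
      pointCount k F (2 * r') ≤ Fintype.card k ^ (2 * r') + (2 * G + 1) * Fintype.card k ^ r' ∧
      Fintype.card k ^ (2 * r') + 1 ≤ pointCount k F (2 * r') +
        (Module.finrank F₀ F - 1) * ((2 * G + 1) * Fintype.card k ^ r') := by
  let kE := algebraicClosure k E
  letI : Fintype kE := Fintype.ofFinite _
  refine ⟨genus kE E, fun r' hr' hg => ?_⟩
  have hn : 0 < 2 * r' * Module.finrank F₀ E := Nat.mul_pos (by omega) Module.finrank_pos
  obtain ⟨ψ, -, hirr, -, hψ⟩ := exists_irreducible_natDegree_eq kE hn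
  have hqr : Fintype.card k ^ (2 * r') = (p ^ (a * r')) ^ 2 := by
    rw [hq, ← pow_mul, ← pow_mul]; ring_nf
  have hqr' : Fintype.card k ^ r' = p ^ (a * r') := by rw [hq, ← pow_mul]
  rw [hqr] at hg
  obtain ⟨hU, hL⟩ := pointCount_bounds_of_irreducible (F := F) kE p hp (by omega) hqr ψ hirr hψ hg
    (h₀ _ (by omega))
  rw [← hqr, ← hqr'] at hU hL
  exact ⟨hU, hL⟩

end GivenClosure

/-! ### The Hasse–Weil theorem -/

section Closure

variable {K : Type u} {F : Type v} [Field K] [Fintype K] [Field F] [Algebra K F]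
  [IsAlgFunctionField K F] [IsIntegrallyClosedIn K F]
universe v₀
variable {F₀ : Type v₀} [Field F₀] [Algebra K F₀] [Algebra F₀ F] [IsScalarTower K F₀ F]
  [FiniteDimensional F₀ F] [Algebra.IsSeparable F₀ F] [IsAlgFunctionField K F₀] [IsIntegrallyClosedIn K F₀]

set_option quotPrecheck false in
/-- A separable closure of `F₀` containing `F` (notation local to this section). -/
local notation "Lsep" => separableClosure F₀ (AlgebraicClosure F)

set_option quotPrecheck false in
/-- The Galois closure of `F/F₀` inside `Lsep` (notation local to this section). -/
local notation "Ecl" => IntermediateField.normalClosure F₀ F Lsep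

/-- **The estimate for `F ⊇ F₀ ⊇ 𝔽_q`, `F/F₀` finite separable with `N_r(F₀) = q^r + 1`**, through
the Galois closure `E` of `F/F₀` inside a separable closure and `exists_pointCount_bounds`.
[cite: Stichtenoth2009, proof of Thm. 5.2.1] -/
theorem exists_pointCount_bounds_of_separable (p a : ℕ) (hp : p.Prime) [CharP K p]
    (hq : Fintype.card K = p ^ a)
    (h₀ : ∀ r : ℕ, 0 < r → pointCount K F₀ r = Fintype.card K ^ r + 1) :
    ∃ G : ℕ, ∀ r' : ℕ, 0 < r' → (G + 1) ^ 4 < Fintype.card K ^ (2 * r') →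
      pointCount K F (2 * r') ≤ Fintype.card K ^ (2 * r') + (2 * G + 1) * Fintype.card K ^ r' ∧
      Fintype.card K ^ (2 * r') + 1 ≤ pointCount K F (2 * r') +
        (Module.finrank F₀ F - 1) * ((2 * G + 1) * Fintype.card K ^ r') := by
  haveI : Algebra.IsAlgebraic F₀ F := Algebra.IsAlgebraic.of_finite _ _
  -- `F → Lsep`
  have hmem : ∀ y : F, algebraMap F (AlgebraicClosure F) y ∈ Lsep := fun y =>
    mem_separableClosure_iff.2 ((Algebra.IsSeparable.isSeparable F₀ y).map
      (IsScalarTower.toAlgHom F₀ F (AlgebraicClosure F)) (algebraMap F (AlgebraicClosure F)).injective)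
  let i : F →+* Lsep :=
    { toFun := fun y => ⟨algebraMap F (AlgebraicClosure F) y, hmem y⟩
      map_one' := Subtype.ext (map_one _)
      map_mul' := fun y z => Subtype.ext (map_mul _ y z)
      map_zero' := Subtype.ext (map_zero _)
      map_add' := fun y z => Subtype.ext (map_add _ y z) }
  letI : Algebra F Lsep := i.toAlgebra
  haveI : IsScalarTower F₀ F Lsep := IsScalarTower.of_algebraMap_eq fun x =>
    Subtype.ext (IsScalarTower.algebraMap_apply F₀ F (AlgebraicClosure F) x)
  -- instances for the Galois closure
  haveI : IsGalois F₀ Ecl := IsGalois.normalClosure F₀ F Lsep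
  haveI : FiniteDimensional F₀ Ecl := normalClosure.is_finiteDimensional F₀ F Lsep
  haveI : FiniteDimensional F Ecl := Module.Finite.of_restrictScalars_finite F₀ F Ecl
  haveI : IsGalois F Ecl := IsGalois.tower_top_of_isGalois F₀ F Ecl
  haveI : IsScalarTower K F Ecl := IsScalarTower.of_algebraMap_eq fun c => by
    rw [IsScalarTower.algebraMap_apply K F₀ F, ← IsScalarTower.algebraMap_apply F₀ F Ecl,
      ← IsScalarTower.algebraMap_apply K F₀ Ecl]
  haveI : IsAlgFunctionField K Ecl := isAlgFunctionField_of_finiteDimensional (K := K) (F := F)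
  exact exists_pointCount_bounds (k := K) (F₀ := F₀) (F := F) Ecl p a hp hq h₀

end Closure

section Final

variable {K : Type u} {F : Type v} [Field K] [Fintype K] [Field F] [Algebra K F]

/-- **The estimate (5.23)/(5.24) for `F/𝔽_q`** along even degrees: there are `G, n₀` with
`N_{2r'} ≤ q^{2r'} + (2G+1) q^{r'}` and `q^{2r'} + 1 ≤ N_{2r'} + n₀ (2G+1) q^{r'}` for all `r'` with
`q^{2r'} > (G+1)⁴` — from a separating element `t` (Prop. 3.10.2) and
`exists_pointCount_bounds_of_separable` for `F₀ = 𝔽_q(t)` (`N_r(F₀) = q^r + 1`).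
[cite: Stichtenoth2009, proof of Thm. 5.2.1] -/
theorem exists_pointCount_bounds_even [IsAlgFunctionField K F] [IsIntegrallyClosedIn K F] :
    ∃ G n₀ : ℕ, ∀ r' : ℕ, 0 < r' → (G + 1) ^ 4 < Fintype.card K ^ (2 * r') →
      pointCount K F (2 * r') ≤ Fintype.card K ^ (2 * r') + (2 * G + 1) * Fintype.card K ^ r' ∧
      Fintype.card K ^ (2 * r') + 1 ≤ pointCount K F (2 * r') +
        n₀ * ((2 * G + 1) * Fintype.card K ^ r') := by
  obtain ⟨p, hchar, n, hp, hq⟩ := FiniteField.card' K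
  haveI := hchar
  obtain ⟨t, ht, hsep⟩ := exists_separating (K := K) (F := F)
  haveI := hsep
  haveI : FiniteDimensional K⟮t⟯ F := IsAlgFunctionField.finiteDimensional_adjoin_simple ht
  haveI : IsAlgFunctionField K K⟮t⟯ := isAlgFunctionField_adjoin_simple ht
  haveI : IsIntegrallyClosedIn K K⟮t⟯ := isIntegrallyClosedIn_intermediateField _
  obtain ⟨G, hG⟩ := exists_pointCount_bounds_of_separable (K := K) (F := F) (F₀ := K⟮t⟯) p n hp hq
    (fun r hr => pointCount_adjoin_simple ht hr)
  exact ⟨G, Module.finrank K⟮t⟯ F - 1, hG⟩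

/-- **`|N_{ks} - (q^{ks} + 1)| ≤ c √q^{ks}`** along the multiples of a fixed even `k`.
[cite: Stichtenoth2009, proof of Thm. 5.2.1] -/
theorem exists_abs_pointCount_sub_le [IsAlgFunctionField K F] [IsIntegrallyClosedIn K F] :
    ∃ k : ℕ, 0 < k ∧ ∃ c : ℝ, ∀ s : ℕ, 0 < s →
      |(pointCount K F (k * s) : ℝ) - ((Fintype.card K : ℝ) ^ (k * s) + 1)| ≤
        c * Real.sqrt (Fintype.card K) ^ (k * s) := by
  obtain ⟨G, n₀, h⟩ := exists_pointCount_bounds_even (K := K) (F := F)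
  set q := Fintype.card K with hq
  have hq1 : 1 < q := Fintype.one_lt_card
  -- `r₀' := (G+1)^4` gives `q^{2 r₀'} > (G+1)^4`
  set r₀ : ℕ := (G + 1) ^ 4 with hr₀
  have hr₀pos : 0 < r₀ := by positivity
  refine ⟨2 * r₀, by omega, (n₀ + 1) * (2 * G + 1), fun s hs => ?_⟩
  have hlarge : (G + 1) ^ 4 < q ^ (2 * (r₀ * s)) := by
    calc (G + 1) ^ 4 = r₀ := rfl
      _ < 2 ^ r₀ := Nat.lt_two_pow_self
      _ ≤ q ^ r₀ := Nat.pow_le_pow_left hq1 _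
      _ ≤ q ^ (2 * (r₀ * s)) := Nat.pow_le_pow_right (by omega) (by nlinarith)
  obtain ⟨hU, hL⟩ := h (r₀ * s) (Nat.mul_pos hr₀pos hs) hlarge
  have hks : 2 * r₀ * s = 2 * (r₀ * s) := by ring
  rw [hks]
  -- `√q ^ (2 m) = q ^ m`
  have hsqrt : Real.sqrt q ^ (2 * (r₀ * s)) = (q : ℝ) ^ (r₀ * s) := by
    rw [pow_mul, Real.sq_sqrt (by positivity)]
  rw [hsqrt]
  have hqpos : (0 : ℝ) ≤ (q : ℝ) ^ (r₀ * s) := by positivity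
  have hX : (0 : ℝ) ≤ (2 * G + 1) * (q : ℝ) ^ (r₀ * s) := by positivity
  have hnX : (0 : ℝ) ≤ n₀ * ((2 * G + 1) * (q : ℝ) ^ (r₀ * s)) := by positivity
  have hexp : ((n₀ : ℝ) + 1) * (2 * (G : ℝ) + 1) * (q : ℝ) ^ (r₀ * s) =
      (2 * G + 1) * (q : ℝ) ^ (r₀ * s) + n₀ * ((2 * G + 1) * (q : ℝ) ^ (r₀ * s)) := by ring
  rw [hexp, abs_sub_le_iff]
  constructor
  · have hU' : (pointCount K F (2 * (r₀ * s)) : ℝ) ≤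
        (q : ℝ) ^ (2 * (r₀ * s)) + (2 * G + 1) * (q : ℝ) ^ (r₀ * s) := by
      exact_mod_cast hU
    linarith
  · have hL' : (q : ℝ) ^ (2 * (r₀ * s)) + 1 ≤ pointCount K F (2 * (r₀ * s)) +
        n₀ * ((2 * G + 1) * (q : ℝ) ^ (r₀ * s)) := by
      exact_mod_cast hL
    linarith

/-- **The Hasse–Weil theorem (Riemann hypothesis for function fields over finite fields;
Stichtenoth Thm. 5.2.1): discharge of the named fact `hasseWeil`.** The reciprocal roots of the
`L`-polynomial of `F/𝔽_q` all have absolute value `√q`. Proof (Bombieri–Stepanov, in the twisted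
form): the estimate `|N_{ks} - (q^{ks}+1)| ≤ c q^{ks/2}` along an arithmetic progression of even
degrees (`exists_abs_pointCount_sub_le`) and the reduction
`hasseWeil_of_abs_pointCount_sub_le` (Cor. 5.1.16, Lemma 5.2.2, power sums).
[cite: Stichtenoth2009, Thm. 5.2.1] -/
theorem hasseWeil_holds : hasseWeil K F := by
  intro _ _ L hL z hz
  obtain ⟨k, hk, c, hc⟩ := exists_abs_pointCount_sub_le (K := K) (F := F)
  exact norm_inv_eq_sqrt_of_abs_pointCount_sub_le hk c hc L hL z hz

end Final

/-- **The genus read off from the zeta function is the genus (Weil 1948): discharge of the named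
fact `isGenus_genus`.** For a function field `F/𝔽_q` with full constant field `𝔽_q`, Weil's counting
characterisation `IsGenus Fq F g` holds for `g` the (Riemann–Roch) genus: by F. K. Schmidt's
rationality theorem the `L`-polynomial has degree `2g`, and by the Hasse–Weil theorem
(`hasseWeil_holds`) its reciprocal roots have absolute value `√q`.
[cite: Weil1948] [cite: Stichtenoth2009, Thm. 5.1.15 and Thm. 5.2.1] -/
theorem isGenus_genus_holds {Fq F : Type} [Field Fq] [Fintype Fq] [Field F] [Algebra Fq F] :
    isGenus_genus Fq F :=
  isGenus_genus_of_hasseWeil hasseWeil_holds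

end Literature.NumberTheory.DiophantineGeometry.AlgFunctionField
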